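import Summits.HodgeConjecture.HodgeCM.Automorphic.KernelModelHeisenbergPairSeesaw_1

/-! PORT of `HodgeCM/Automorphic/KernelModelHeisenbergPairSeesaw.lean` (HodgeCMPerL run 82) — part 2: continuation of `Summits.HodgeConjecture.HodgeCM.Automorphic.KernelModelHeisenbergPairSeesaw_1` (split at a top-level declaration boundary by port_pkg.py; scope re-opened below; declarations unchanged). -/

-- port_pkg: scope re-opened for this part (file-level context, then the namespace/section stack open at the cut)
set_option autoImplicit false
noncomputable section
open MeasureTheory Topology
open HodgeCM.PerL34 HodgeCM.PerL34.Annihilation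
open scoped RealInnerProductSpace FourierTransform SchwartzMap CompactlySupported
attribute [-instance] Quotient.instMeasurableSpace
namespace HodgeCM
namespace SchwartzWeil
namespace HeisenbergPair
open HeisenbergKernel
attribute [local instance] borelCircle borelSpace_circle borelT borelSpace_T
variable (V : Type) [NormedAddCommGroup V] [InnerProductSpace ℝ V] [FiniteDimensional ℝ V] [MeasurableSpace V]
  [BorelSpace V] (K : Submodule ℝ V) (L₁ : Submodule ℤ K) [DiscreteTopology L₁] [IsZLattice ℝ L₁]
  (L₂ : Submodule ℤ Kᗮ) [DiscreteTopology L₂] [IsZLattice ℝ L₂] (m : ℤ) [NeZero m]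
/-- **NON-VANISHING OF THE DOUBLY-TORIC PERIOD: for EVERY pair of allowed characters `(ξ₁, ξ₂)` some Schwartz `Φ`
has `P(ξ₁, ξ₂; Φ) ≠ 0`.**  Pick `tᵢ⁰` with `βᵢ(tᵢ⁰) ≠ 0`, `δ` below the `¼`-continuity moduli of both phases
`a ↦ ξᵢ(a, 1)` at `aᵢ⁰`, and `Φ` a bump of radius `≤ δ` at `a₁⁰ + a₂⁰` isolated in `L`.  Wherever the non-negative
majorant `g = β₁β₂ · Σ_L φ(v − a₁ − a₂)` is non-zero some `v = l₁ + l₂ ∈ L` has `‖(l₁ − a₁ + a₁⁰) + (l₂ − a₂ + a₂⁰)‖ < δ`,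
whence (orthogonality) BOTH `aᵢ − lᵢ` are `δ`-close to `aᵢ⁰`, and by `Lᵢ`-periodicity the phase `ξ₁(a₁,1)ξ₂(a₂,1)`
is `½`-close to its value at `(a₁⁰, a₂⁰)`; so `|P − phase₀ · ∫g| ≤ ½ ∫g < ∫g = |phase₀ · ∫g|`. -/
theorem doublePeriod_ne_zero (χ₁ : Xw K L₁ m) (χ₂ : Xw Kᗮ L₂ m) :
    ∃ Φ : 𝓢(V, ℂ), doublePeriod V K L₁ L₂ m χ₁ χ₂ Φ ≠ 0 := by
  obtain ⟨t₁, ht₁⟩ := exists_β_ne_zero K L₁ m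
  obtain ⟨t₂, ht₂⟩ := exists_β_ne_zero Kᗮ L₂ m
  have hD₁c : Continuous fun a : K =>
      dualChar χ₁.1 (QuotientGroup.mk (Multiplicative.ofAdd a, 1) : (Multiplicative K × Circle) ⧸ ΛT K L₁ m) :=
    (continuous_dualChar χ₁.1).comp (QuotientGroup.continuous_mk.comp (continuous_ofAdd.prodMk continuous_const))
  have hD₂c : Continuous fun a : Kᗮ =>
      dualChar χ₂.1 (QuotientGroup.mk (Multiplicative.ofAdd a, 1) : (Multiplicative Kᗮ × Circle) ⧸ ΛT Kᗮ L₂ m) :=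
    (continuous_dualChar χ₂.1).comp (QuotientGroup.continuous_mk.comp (continuous_ofAdd.prodMk continuous_const))
  obtain ⟨δ₁, hδ₁, hδD₁⟩ := Metric.continuous_iff.mp hD₁c (Multiplicative.toAdd t₁.1) (1 / 4) (by norm_num)
  obtain ⟨δ₂, hδ₂, hδD₂⟩ := Metric.continuous_iff.mp hD₂c (Multiplicative.toAdd t₂.1) (1 / 4) (by norm_num)
  obtain ⟨φ, Φ, hΦφ, hP, hr⟩ := exists_bump_le V (lat V K L₁ L₂)
    (((Multiplicative.toAdd t₁.1 : K) : V) + ((Multiplicative.toAdd t₂.1 : Kᗮ) : V)) (lt_min hδ₁ hδ₂)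
  refine ⟨Φ, ?_⟩
  -- the product torus, its measure, the moving centre `A(p) = a₁ + a₂`
  let P := (Multiplicative K × Circle) × (Multiplicative Kᗮ × Circle)
  let μ : Measure P := (Measure.haar : Measure (Multiplicative K × Circle)).prod
    (Measure.haar : Measure (Multiplicative Kᗮ × Circle))
  let A : P → V := fun p => ((Multiplicative.toAdd p.1.1 : K) : V) + ((Multiplicative.toAdd p.2.1 : Kᗮ) : V)
  have hA : Continuous A :=
    (continuous_subtype_val.comp (continuous_toAdd.comp (continuous_fst.comp continuous_fst))).add
      (continuous_subtype_val.comp (continuous_toAdd.comp (continuous_fst.comp continuous_snd)))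
  -- the real majorant `g = β₁β₂ · Σ_L φ(v − A)`: continuous, compactly supported, `≥ 0`, `∫ g > 0`
  let g : P → ℝ := fun p => β K L₁ m p.1 * β Kᗮ L₂ m p.2 * ∑' v : lat V K L₁ L₂, φ ((v : V) - A p)
  have hPc : ∀ a : V, ∑' v : lat V K L₁ L₂, Φ ((v : V) - a) =
      ((∑' v : lat V K L₁ L₂, φ ((v : V) - a) : ℝ) : ℂ) := fun a => by
    rw [Complex.ofReal_tsum]
    exact tsum_congr fun v => hΦφ _
  have hPcont : Continuous fun a : V => ∑' v : lat V K L₁ L₂, φ ((v : V) - a) := by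
    refine (Complex.continuous_re.comp (continuous_periodisation V (lat V K L₁ L₂) Φ)).congr fun a => ?_
    simp only [Function.comp_apply, hPc, Complex.ofReal_re]
  have hββ_cont : Continuous fun p : P => β K L₁ m p.1 * β Kᗮ L₂ m p.2 :=
    ((β K L₁ m).continuous.comp continuous_fst).mul ((β Kᗮ L₂ m).continuous.comp continuous_snd)
  have hg_cont : Continuous g := hββ_cont.mul (hPcont.comp hA)
  have hg_supp : HasCompactSupport g := (hasCompactSupport_ββ_real V K L₁ L₂ m).mul_right
  have hg_nonneg : 0 ≤ g := fun p =>
    mul_nonneg (mul_nonneg (β_nonneg K L₁ m p.1) (β_nonneg Kᗮ L₂ m p.2)) (tsum_nonneg fun v => φ.nonneg)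
  have hg_p₀ : g (t₁, t₂) ≠ 0 := by
    change β K L₁ m t₁ * β Kᗮ L₂ m t₂ * ∑' v : lat V K L₁ L₂, φ ((v : V) -
      (((Multiplicative.toAdd t₁.1 : K) : V) + ((Multiplicative.toAdd t₂.1 : Kᗮ) : V))) ≠ 0
    rw [hP, mul_one]
    exact mul_ne_zero ht₁ ht₂
  have hg_int : Integrable g μ := hg_cont.integrable_of_hasCompactSupport hg_supp
  have hpos : 0 < ∫ p, g p ∂μ := hg_cont.integral_pos_of_hasCompactSupport_nonneg_nonzero hg_supp hg_nonneg hg_p₀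
  -- the phase `D(p) = ξ₁(a₁, 1) ξ₂(a₂, 1)` (unimodular) and its value at `p₀ = (t₁⁰, t₂⁰)`
  let D : P → ℂ := fun p =>
    dualChar χ₁.1 (QuotientGroup.mk (p.1.1, 1) : (Multiplicative K × Circle) ⧸ ΛT K L₁ m) *
      dualChar χ₂.1 (QuotientGroup.mk (p.2.1, 1) : (Multiplicative Kᗮ × Circle) ⧸ ΛT Kᗮ L₂ m)
  have hD_cont : Continuous D :=
    ((continuous_dualChar χ₁.1).comp (QuotientGroup.continuous_mk.comp
      ((continuous_fst.comp continuous_fst).prodMk continuous_const))).mul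
      ((continuous_dualChar χ₂.1).comp (QuotientGroup.continuous_mk.comp
        ((continuous_fst.comp continuous_snd).prodMk continuous_const)))
  have hD_norm : ∀ p, ‖D p‖ = 1 := fun p => by
    have n1 : ‖(dualChar χ₁.1 (QuotientGroup.mk (p.1.1, 1) : (Multiplicative K × Circle) ⧸ ΛT K L₁ m) : ℂ)‖ = 1 :=
      Circle.norm_coe _
    have n2 : ‖(dualChar χ₂.1 (QuotientGroup.mk (p.2.1, 1) : (Multiplicative Kᗮ × Circle) ⧸ ΛT Kᗮ L₂ m) : ℂ)‖ = 1 :=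
      Circle.norm_coe _
    change ‖(dualChar χ₁.1 _ : ℂ) * (dualChar χ₂.1 _ : ℂ)‖ = 1
    rw [norm_mul, n1, n2, mul_one]
  -- the integrand `H = β₁β₂ · D · Σ_L Φ(v − A)` of `doublePeriod_eq` and the comparison function `D p₀ · g`
  let H : P → ℂ := fun p => ((β K L₁ m p.1 : ℂ) * (β Kᗮ L₂ m p.2 : ℂ)) *
    (dualChar χ₁.1 (QuotientGroup.mk (p.1.1, 1) : (Multiplicative K × Circle) ⧸ ΛT K L₁ m) *
      dualChar χ₂.1 (QuotientGroup.mk (p.2.1, 1) : (Multiplicative Kᗮ × Circle) ⧸ ΛT Kᗮ L₂ m) *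
        ∑' v : lat V K L₁ L₂, Φ ((v : V) - A p))
  have hH_cont : Continuous H :=
    ((Complex.continuous_ofReal.comp ((β K L₁ m).continuous.comp continuous_fst)).mul
      (Complex.continuous_ofReal.comp ((β Kᗮ L₂ m).continuous.comp continuous_snd))).mul
      (hD_cont.mul ((continuous_periodisation V (lat V K L₁ L₂) Φ).comp hA))
  have hH_supp : HasCompactSupport H := (hasCompactSupport_ββ V K L₁ L₂ m).mul_right
  have hH_int : Integrable H μ := hH_cont.integrable_of_hasCompactSupport hH_supp
  have hG_int : Integrable (fun p => D (t₁, t₂) * ((g p : ℝ) : ℂ)) μ := hg_int.ofReal.const_mul (D (t₁, t₂))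
  -- POINTWISE: `‖H p − D p₀ · g p‖ ≤ g p · ½`
  have hpt : ∀ p, ‖H p - D (t₁, t₂) * ((g p : ℝ) : ℂ)‖ ≤ g p * (1 / 2) := by
    intro p
    have e : H p - D (t₁, t₂) * ((g p : ℝ) : ℂ) = ((g p : ℝ) : ℂ) * (D p - D (t₁, t₂)) := by
      change ((β K L₁ m p.1 : ℂ) * (β Kᗮ L₂ m p.2 : ℂ)) * (D p * ∑' v : lat V K L₁ L₂, Φ ((v : V) - A p)) -
          D (t₁, t₂) * ((β K L₁ m p.1 * β Kᗮ L₂ m p.2 * ∑' v : lat V K L₁ L₂, φ ((v : V) - A p) : ℝ) : ℂ) =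
        ((β K L₁ m p.1 * β Kᗮ L₂ m p.2 * ∑' v : lat V K L₁ L₂, φ ((v : V) - A p) : ℝ) : ℂ) * (D p - D (t₁, t₂))
      rw [hPc, Complex.ofReal_mul, Complex.ofReal_mul]
      ring
    rw [e, norm_mul, Complex.norm_real, Real.norm_of_nonneg (hg_nonneg p)]
    by_cases hgp : g p = 0
    · rw [hgp, zero_mul, zero_mul]
    refine mul_le_mul_of_nonneg_left ?_ (hg_nonneg p)
    -- `g p ≠ 0` ⇒ some `φ(v − A p) ≠ 0`, `v = l₁ + l₂` ⇒ BOTH `aᵢ − lᵢ` are `δ`-close to `aᵢ⁰` (orthogonality)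
    have hPt : ∑' v : lat V K L₁ L₂, φ ((v : V) - A p) ≠ 0 := fun h0 => hgp (by
      change β K L₁ m p.1 * β Kᗮ L₂ m p.2 * ∑' v : lat V K L₁ L₂, φ ((v : V) - A p) = 0
      rw [h0, mul_zero])
    obtain ⟨v, hv⟩ : ∃ v : lat V K L₁ L₂, φ ((v : V) - A p) ≠ 0 := by
      by_contra hall
      simp only [not_exists, not_not] at hall
      exact hPt (by rw [tsum_congr hall, tsum_zero])
    obtain ⟨l₁, hl₁, l₂, hl₂, hv12⟩ := (mem_lat V K L₁ L₂).mp v.2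
    have hvdist : dist ((v : V) - A p)
        (-(((Multiplicative.toAdd t₁.1 : K) : V) + ((Multiplicative.toAdd t₂.1 : Kᗮ) : V))) < min δ₁ δ₂ :=
      lt_of_lt_of_le (lt_of_not_ge fun h => hv (φ.zero_of_le_dist h)) hr
    rw [dist_eq_norm, sub_neg_eq_add, ← hv12] at hvdist
    have e : (l₁ : V) + (l₂ : V) - A p +
          (((Multiplicative.toAdd t₁.1 : K) : V) + ((Multiplicative.toAdd t₂.1 : Kᗮ) : V)) =
        ((l₁ : V) - ((Multiplicative.toAdd p.1.1 : K) : V) + ((Multiplicative.toAdd t₁.1 : K) : V)) +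
          ((l₂ : V) - ((Multiplicative.toAdd p.2.1 : Kᗮ) : V) + ((Multiplicative.toAdd t₂.1 : Kᗮ) : V)) := by
      change (l₁ : V) + (l₂ : V) -
          (((Multiplicative.toAdd p.1.1 : K) : V) + ((Multiplicative.toAdd p.2.1 : Kᗮ) : V)) + _ = _
      abel
    rw [e] at hvdist
    have hm₁ : (l₁ : V) - ((Multiplicative.toAdd p.1.1 : K) : V) + ((Multiplicative.toAdd t₁.1 : K) : V) ∈ K :=
      K.add_mem (K.sub_mem l₁.2 (Multiplicative.toAdd p.1.1).2) (Multiplicative.toAdd t₁.1).2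
    have hm₂ : (l₂ : V) - ((Multiplicative.toAdd p.2.1 : Kᗮ) : V) + ((Multiplicative.toAdd t₂.1 : Kᗮ) : V) ∈ Kᗮ :=
      Kᗮ.add_mem (Kᗮ.sub_mem l₂.2 (Multiplicative.toAdd p.2.1).2) (Multiplicative.toAdd t₂.1).2
    have hdist₁ : dist (Multiplicative.toAdd p.1.1 - l₁) (Multiplicative.toAdd t₁.1) < δ₁ := by
      rw [dist_eq_norm, Submodule.coe_norm, Submodule.coe_sub, Submodule.coe_sub]
      have e' : ‖((Multiplicative.toAdd p.1.1 : K) : V) - (l₁ : V) - ((Multiplicative.toAdd t₁.1 : K) : V)‖ =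
          ‖(l₁ : V) - ((Multiplicative.toAdd p.1.1 : K) : V) + ((Multiplicative.toAdd t₁.1 : K) : V)‖ := by
        rw [← norm_neg]
        congr 1
        abel
      rw [e']
      exact lt_of_le_of_lt (norm_le_norm_add_of_mem' V K hm₁ hm₂) (lt_of_lt_of_le hvdist (min_le_left _ _))
    have hdist₂ : dist (Multiplicative.toAdd p.2.1 - l₂) (Multiplicative.toAdd t₂.1) < δ₂ := by
      rw [dist_eq_norm, Submodule.coe_norm, Submodule.coe_sub, Submodule.coe_sub]
      have e' : ‖((Multiplicative.toAdd p.2.1 : Kᗮ) : V) - (l₂ : V) - ((Multiplicative.toAdd t₂.1 : Kᗮ) : V)‖ =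
          ‖(l₂ : V) - ((Multiplicative.toAdd p.2.1 : Kᗮ) : V) + ((Multiplicative.toAdd t₂.1 : Kᗮ) : V)‖ := by
        rw [← norm_neg]
        congr 1
        abel
      rw [e']
      exact lt_of_le_of_lt (norm_le_norm_add_of_mem V K hm₁ hm₂) (lt_of_lt_of_le hvdist (min_le_right _ _))
    -- by `Lᵢ`-periodicity the phases at `aᵢ` equal the phases at `aᵢ − lᵢ`, `¼`-close to those at `aᵢ⁰`
    have hclose₁ := hδD₁ (Multiplicative.toAdd p.1.1 - l₁) hdist₁
    rw [← dualChar_mk_ofAdd_sub K L₁ m χ₁.1 (Multiplicative.toAdd p.1.1) hl₁, ofAdd_toAdd, ofAdd_toAdd,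
      dist_eq_norm] at hclose₁
    have hclose₂ := hδD₂ (Multiplicative.toAdd p.2.1 - l₂) hdist₂
    rw [← dualChar_mk_ofAdd_sub Kᗮ L₂ m χ₂.1 (Multiplicative.toAdd p.2.1) hl₂, ofAdd_toAdd, ofAdd_toAdd,
      dist_eq_norm] at hclose₂
    -- `‖x y − x₀ y₀‖ ≤ ‖x − x₀‖‖y‖ + ‖x₀‖‖y − y₀‖ < ¼ + ¼`
    have n₂ : ‖(dualChar χ₂.1 (QuotientGroup.mk (p.2.1, 1) : (Multiplicative Kᗮ × Circle) ⧸ ΛT Kᗮ L₂ m) : ℂ)‖ = 1 :=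
      Circle.norm_coe _
    have n₁ : ‖(dualChar χ₁.1 (QuotientGroup.mk (t₁.1, 1) : (Multiplicative K × Circle) ⧸ ΛT K L₁ m) : ℂ)‖ = 1 :=
      Circle.norm_coe _
    have eD : D p - D (t₁, t₂) =
        ((dualChar χ₁.1 (QuotientGroup.mk (p.1.1, 1) : (Multiplicative K × Circle) ⧸ ΛT K L₁ m) : ℂ) -
            dualChar χ₁.1 (QuotientGroup.mk (t₁.1, 1) : (Multiplicative K × Circle) ⧸ ΛT K L₁ m)) *
          dualChar χ₂.1 (QuotientGroup.mk (p.2.1, 1) : (Multiplicative Kᗮ × Circle) ⧸ ΛT Kᗮ L₂ m) +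
        dualChar χ₁.1 (QuotientGroup.mk (t₁.1, 1) : (Multiplicative K × Circle) ⧸ ΛT K L₁ m) *
          ((dualChar χ₂.1 (QuotientGroup.mk (p.2.1, 1) : (Multiplicative Kᗮ × Circle) ⧸ ΛT Kᗮ L₂ m) : ℂ) -
            dualChar χ₂.1 (QuotientGroup.mk (t₂.1, 1) : (Multiplicative Kᗮ × Circle) ⧸ ΛT Kᗮ L₂ m)) := by
      change (dualChar χ₁.1 _ : ℂ) * (dualChar χ₂.1 _ : ℂ) - (dualChar χ₁.1 _ : ℂ) * (dualChar χ₂.1 _ : ℂ) = _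
      ring
    rw [eD]
    refine le_trans (norm_add_le _ _) ?_
    rw [norm_mul, norm_mul, n₁, n₂, mul_one, one_mul]
    linarith [hclose₁.le, hclose₂.le]
  -- INTEGRATE: `‖P − D p₀ · ∫ g‖ ≤ ½ ∫ g`, `‖D p₀ · ∫ g‖ = ∫ g > 0`
  have hbound : ‖(∫ p, H p ∂μ) - D (t₁, t₂) * ((∫ p, g p ∂μ : ℝ) : ℂ)‖ ≤ ∫ p, g p * (1 / 2) ∂μ := by
    rw [← integral_complex_ofReal, ← integral_const_mul, ← integral_sub hH_int hG_int]
    exact norm_integral_le_of_norm_le (hg_int.mul_const _) (Filter.Eventually.of_forall hpt)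
  have hGnorm : ‖D (t₁, t₂) * ((∫ p, g p ∂μ : ℝ) : ℂ)‖ = ∫ p, g p ∂μ := by
    rw [norm_mul, hD_norm, one_mul, Complex.norm_real, Real.norm_of_nonneg hpos.le]
  have hhalf : ∫ p, g p * (1 / 2) ∂μ = (∫ p, g p ∂μ) * (1 / 2) := integral_mul_const _ _
  have key : (∫ p, g p ∂μ) * (1 / 2) ≤ ‖∫ p, H p ∂μ‖ := by
    have := norm_sub_norm_le (D (t₁, t₂) * ((∫ p, g p ∂μ : ℝ) : ℂ)) (∫ p, H p ∂μ)
    rw [hGnorm, ← norm_sub_rev] at this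
    linarith
  rw [doublePeriod_eq]
  intro h0
  change (∫ p, H p ∂μ) = 0 at h0
  rw [h0, norm_zero] at key
  linarith

/-! ## 4. Corollaries through the seesaw: both inner toric-period FUNCTIONS are non-zero for every character -/

/-- **For every allowed `ξ₁ ∈ Xw K L₁ m` some Schwartz `Φ` has `ϑ^{swap}_{T₁,ξ₁}(Φ) ≠ 0` in `C([Heis Kᗮ])`** (the
swapped lift's toric-period function): a vanishing inner function kills the right-hand side of the seesaw, hence the
doubly-toric period (taken against the trivial-weight character `χ₀` on the other torus). -/
theorem ϑcSwap_ne_zero (χ₁ : Xw K L₁ m) : ∃ Φ : 𝓢(V, ℂ),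
    (torusCarrierSwap V K L₁ L₂ m).ϑc χ₁ ⟨Φ, Set.mem_univ Φ⟩ ≠ 0 := by
  obtain ⟨Φ, hΦ⟩ := doublePeriod_ne_zero V K L₁ L₂ m χ₁ ⟨χ₀ Kᗮ L₂ m, χ₀_mem Kᗮ L₂ m⟩
  refine ⟨Φ, fun h0 => hΦ ?_⟩
  rw [seesaw, h0]
  simp only [ContinuousMap.zero_apply, mul_zero, integral_zero]

/-- … and symmetrically `ϑ_{T₂,ξ₂}(Φ) ≠ 0` in `C([Heis K])` for some `Φ` (also immediate from the pair file's
`ϑc_ne_zero_of_mem`; recorded here as the other face of the same double period). -/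
theorem ϑc_ne_zero' (χ₂ : Xw Kᗮ L₂ m) : ∃ Φ : 𝓢(V, ℂ),
    (torusCarrier V K L₁ L₂ m).ϑc χ₂ ⟨Φ, Set.mem_univ Φ⟩ ≠ 0 := by
  obtain ⟨Φ, hΦ⟩ := doublePeriod_ne_zero V K L₁ L₂ m ⟨χ₀ K L₁ m, χ₀_mem K L₁ m⟩ χ₂
  refine ⟨Φ, fun h0 => hΦ ?_⟩
  unfold doublePeriod
  rw [h0]
  simp only [ContinuousMap.zero_apply, mul_zero, integral_zero]

/-! ### Smoke: the instance hypotheses are met (`V = ℝ³`, any subspace `K`, basis spans, any weight `m ≠ 0`) -/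
example (K : Submodule ℝ (EuclideanSpace ℝ (Fin 3))) (m : ℤ) [NeZero m]
    (χ₁ : Xw K (Submodule.span ℤ (Set.range (Module.finBasis ℝ K))) m)
    (χ₂ : Xw Kᗮ (Submodule.span ℤ (Set.range (Module.finBasis ℝ Kᗮ))) m) :
    ∃ Φ : 𝓢(EuclideanSpace ℝ (Fin 3), ℂ),
      doublePeriod (EuclideanSpace ℝ (Fin 3)) K (Submodule.span ℤ (Set.range (Module.finBasis ℝ K)))
        (Submodule.span ℤ (Set.range (Module.finBasis ℝ Kᗮ))) m χ₁ χ₂ Φ ≠ 0 :=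
  doublePeriod_ne_zero _ K _ _ m χ₁ χ₂

end HeisenbergPair

end SchwartzWeil
end HodgeCM

end
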